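import Summits.Parity.GeneralizedHardyLittlewood.Theorems.LeeYangFibresAbsoluteUpgradeUniformDefs
import Summits.Parity.GeneralizedHardyLittlewood.Theorems.LeeYangFibresAbsoluteUpgradeUniformGrowth
import Summits.Parity.GeneralizedHardyLittlewood.Theorems.LeeYangFibresAbsoluteUpgradeUniformCollisionForms
import Summits.Parity.GeneralizedHardyLittlewood.Theorems.LeeYangFibresRelativeDimOneDegenerateCount
import Summits.Parity.GeneralizedHardyLittlewood.Theorems.LeeYangFibresRelativeDimOneSingularTail
import Literature.NumberTheory.Sieve.GallagherSingularSeries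
import Mathlib.Analysis.Complex.ExponentialBounds
import HarnessLib

/-!
# Route `LeeYangFibres`, crux `AbsoluteUpgrade` (stmt-Parity-14116), line `Sketch` (uniform amplification):
# D2 = `TailCollisions` (Rankin's trick for the collision moduli `> √N`) and the stub `stub_collisionFormFactsAndTail`

Pointwise in a NON-DEGENERATE shift `H ∈ [-2N,2N]^m`, with `T = (m+1)t ≤ (log log N)^A`, `y = truncLevel N` and the
collision weights `c_p = collisionCount(H,p)/(p − T)` at the primes `p` of the window `(y, x]`:
`∑_{Q ⊆ primes(y,x], ∏Q > √N} ∏_{p ∈ Q} c_p ≤ η` for `N ≥ N₀(L, A, η)`.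

Proof (Rankin with exponent `1/2`). On the range `∏Q > √N` one has `N^{1/4} ≤ ∏_{p∈Q} √p`, so the sum is at most
`N^{-1/4} ∑_{Q} ∏_{p∈Q} c_p √p = N^{-1/4} ∏_{p}(1 + c_p √p) ≤ N^{-1/4} exp(∑_p c_p √p)` and `c_p √p ≤ 2 c.c.(H,p)/√y`
(`p ≥ 2T`, `p > y`). FEW COLLISION PRIMES: every collision form `Δ` with `j ≠ j'` is non-zero (`collisionForm_ne_zero`)
of size `≤ 6L²N` (`natAbs_collisionForm_le`), so it has `≤ log(6L²N)/log y` prime factors `> y`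
(`Gallagher.card_primes_dvd_le`), whence `∑_p collisionCount(H,p) ≤ T² log(6L²N)/log y ≤ 2T² log N/log y`
(`sum_collisionCount_le`) and the exponent is `≤ 4T² log N/(√y log y) ≤ (log N)/8` once `√y ≥ 32T²`, `log y ≥ 1`
(uniformly in `T ≤ (log log N)^A`: `y ≥ 1024 T⁴` eventually, `eventually_mul_pow_le_truncLevel`). Total:
`N^{-1/4} N^{1/8} = N^{-1/8} ≤ η`.

References: P. X. Gallagher, Mathematika 23 (1976), §2 and eq. (7) [Gallagher1976]; B. Green, T. Tao, Ann. of Math.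
171 (2010), Lemma 1.3 [GreenTao2010].
-/

noncomputable section

open scoped BigOperators Classical Topology
open Finset Filter MeasureTheory Literature.NumberTheory.Sieve
open Summit.Parity.GeneralizedHardyLittlewood.Cruxes.RelativeDimOne.TranslateAmplification

namespace Summit.Parity.GeneralizedHardyLittlewood.Cruxes.AbsoluteUpgrade.UniformAmplification

variable {t m : ℕ}

/-! ### Few collision primes -/

/-- **Few collision primes.** For a non-degenerate translate-constellation `Ψ^{(H)}` with `‖Ψ‖_N ≤ L`, `N ≥ 1`,
`H ∈ [-2N,2N]^m`, and any finite set `W` of primes `> y ≥ 2`: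
`∑_{p ∈ W} collisionCount(H, p) ≤ ((m+1)t)² · log(6L²N)/log y` — double counting over the `(m+1)² t²` collision
indices; for an index with `j ≠ j'` the collision form is a non-zero integer of size `≤ 6L²N`
(`collisionForm_ne_zero`, `natAbs_collisionForm_le`), which has at most `log(6L²N)/log y` prime factors `> y`
(`Gallagher.card_primes_dvd_le`). [cite: Gallagher1976, Section 2] -/
theorem sum_collisionCount_le (Ψ : Fin t → AffLinForm 1) (H : Fin m → ℤ)
    (hH : IsNondegenerateSystem (translateFamily Ψ H)) {N L y : ℕ} (hN : 1 ≤ N) (hL : affLinSize Ψ N ≤ L)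
    (hHb : H ∈ shiftBox m N) (hy : 2 ≤ y) (W : Finset ℕ) (hW : ∀ p ∈ W, p.Prime ∧ y < p) :
    ∑ p ∈ W, (collisionCount Ψ H p : ℝ) ≤
      (((m + 1) * t : ℕ) : ℝ) ^ 2 * (Real.log ((6 * L ^ 2 * N : ℕ) : ℝ) / Real.log y) := by
  have hlogy : 0 < Real.log y := Real.log_pos (by exact_mod_cast (by omega : 1 < y))
  have hB0 : 0 ≤ Real.log ((6 * L ^ 2 * N : ℕ) : ℝ) / Real.log y :=
    div_nonneg (Real.log_natCast_nonneg _) hlogy.le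
  -- one collision index at a time
  have hper : ∀ x : CollisionIndex m t,
      (#(W.filter fun p : ℕ => x.1.1 ≠ x.1.2 ∧ (p : ℤ) ∣ collisionForm Ψ H x.1.1 x.1.2 x.2.1 x.2.2) : ℝ) ≤
        Real.log ((6 * L ^ 2 * N : ℕ) : ℝ) / Real.log y := by
    intro x
    by_cases hx : x.1.1 = x.1.2
    · rw [Finset.filter_false_of_mem (fun p _ hp => hp.1 hx), Finset.card_empty, Nat.cast_zero]
      exact hB0
    · have hne := collisionForm_ne_zero Ψ H hH x.2.1 x.2.2 hx
      have hle : (collisionForm Ψ H x.1.1 x.1.2 x.2.1 x.2.2).natAbs ≤ 6 * L ^ 2 * N := by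
        have := natAbs_collisionForm_le Ψ H hN hL hHb x.1.1 x.1.2 x.2.1 x.2.2
        exact_mod_cast this
      refine Gallagher.card_primes_dvd_le (Int.natAbs_pos.mpr hne) hle hy _ fun p hp => ?_
      rw [Finset.mem_filter] at hp
      exact ⟨(hW p hp.1).1, (hW p hp.1).2, Int.natCast_dvd.mp hp.2.2⟩
  -- double counting
  calc ∑ p ∈ W, (collisionCount Ψ H p : ℝ)
      = ∑ p ∈ W, ∑ x : CollisionIndex m t,
          (if x.1.1 ≠ x.1.2 ∧ (p : ℤ) ∣ collisionForm Ψ H x.1.1 x.1.2 x.2.1 x.2.2 then (1 : ℝ) else 0) := by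
        refine Finset.sum_congr rfl fun p _ => ?_
        unfold collisionCount
        rw [Finset.natCast_card_filter]
    _ = ∑ x : CollisionIndex m t, ∑ p ∈ W,
          (if x.1.1 ≠ x.1.2 ∧ (p : ℤ) ∣ collisionForm Ψ H x.1.1 x.1.2 x.2.1 x.2.2 then (1 : ℝ) else 0) :=
        Finset.sum_comm
    _ = ∑ x : CollisionIndex m t,
          (#(W.filter fun p : ℕ => x.1.1 ≠ x.1.2 ∧ (p : ℤ) ∣ collisionForm Ψ H x.1.1 x.1.2 x.2.1 x.2.2) : ℝ) := by
        refine Finset.sum_congr rfl fun x _ => ?_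
        rw [Finset.natCast_card_filter]
    _ ≤ ∑ _x : CollisionIndex m t, Real.log ((6 * L ^ 2 * N : ℕ) : ℝ) / Real.log y :=
        Finset.sum_le_sum fun x _ => hper x
    _ = (((m + 1) * t : ℕ) : ℝ) ^ 2 * (Real.log ((6 * L ^ 2 * N : ℕ) : ℝ) / Real.log y) := by
        rw [Finset.sum_const, Finset.card_univ, nsmul_eq_mul]
        simp only [Fintype.card_prod, Fintype.card_fin]
        push_cast
        ring

/-! ### Elementary analysis -/

/-- `∏ (1 + u_p) ≤ exp(∑ u_p)` for `u_p ≥ 0` (`1 + u ≤ e^u`). [folklore] -/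
theorem prod_one_add_le_exp_sum (s : Finset ℕ) (u : ℕ → ℝ) (hu : ∀ p ∈ s, 0 ≤ u p) :
    ∏ p ∈ s, (1 + u p) ≤ Real.exp (∑ p ∈ s, u p) := by
  rw [Real.exp_sum]
  exact Finset.prod_le_prod (fun p hp => by linarith [hu p hp]) fun p _ => by
    linarith [Real.add_one_le_exp (u p)]

/-- RANKIN'S TRICK (exponent `1/2`), one term: if `√N < ∏_{p ∈ Q} p` then for non-negative weights
`∏_{p∈Q} c_p ≤ N^{-1/4} ∏_{p∈Q} c_p √p` (`N^{1/4} ≤ √(∏ p) = ∏ √p`). [cite: Gallagher1976, Section 2] -/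
theorem prod_le_rankin (Q : Finset ℕ) (c : ℕ → ℝ) (hc : ∀ p ∈ Q, 0 ≤ c p) {N : ℕ} (hN : 1 ≤ N)
    (hQ : Nat.sqrt N < ∏ p ∈ Q, p) :
    ∏ p ∈ Q, c p ≤ (Real.sqrt (Real.sqrt N))⁻¹ * ∏ p ∈ Q, (c p * Real.sqrt p) := by
  set R := Real.sqrt (Real.sqrt N) with hRdef
  have hN0 : (0 : ℝ) < N := by exact_mod_cast hN
  have hR0 : 0 < R := Real.sqrt_pos.mpr (Real.sqrt_pos.mpr hN0)
  have hP : (N : ℝ) < (∏ p ∈ Q, (p : ℝ)) * ∏ p ∈ Q, (p : ℝ) := by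
    have h1 : ((N : ℕ) : ℝ) < (((∏ p ∈ Q, p) * ∏ p ∈ Q, p : ℕ) : ℝ) := by exact_mod_cast Nat.sqrt_lt.mp hQ
    rw [Nat.cast_mul, Nat.cast_prod] at h1
    exact h1
  have hP0 : 0 ≤ ∏ p ∈ Q, (p : ℝ) := Finset.prod_nonneg fun p _ => Nat.cast_nonneg p
  have hRle : R ≤ ∏ p ∈ Q, Real.sqrt p := by
    rw [← Real.sqrt_prod Q (fun p _ => Nat.cast_nonneg p), hRdef]
    refine Real.sqrt_le_sqrt ?_
    calc Real.sqrt N ≤ Real.sqrt ((∏ p ∈ Q, (p : ℝ)) * ∏ p ∈ Q, (p : ℝ)) := Real.sqrt_le_sqrt hP.le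
      _ = ∏ p ∈ Q, (p : ℝ) := Real.sqrt_mul_self hP0
  have hc0 : 0 ≤ ∏ p ∈ Q, c p := Finset.prod_nonneg hc
  rw [Finset.prod_mul_distrib]
  calc ∏ p ∈ Q, c p = R⁻¹ * ((∏ p ∈ Q, c p) * R) := by
        rw [eq_inv_mul_iff_mul_eq₀ hR0.ne', mul_comm]
    _ ≤ R⁻¹ * ((∏ p ∈ Q, c p) * ∏ p ∈ Q, Real.sqrt p) :=
        mul_le_mul_of_nonneg_left (mul_le_mul_of_nonneg_left hRle hc0) (inv_nonneg.mpr hR0.le)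

/-- The weight bound at a prime of the window: for `p ≥ 2T`, `p > y > 0`,
`(c/(p − T)) √p ≤ c · 2/√y` (`p − T ≥ p/2`, `√p √y ≤ p`). [folklore] -/
theorem div_mul_sqrt_le {cc p T y : ℝ} (hcc : 0 ≤ cc) (hy : 0 < y) (hyp : y < p) (hTp : 2 * T ≤ p) :
    cc / (p - T) * Real.sqrt p ≤ cc * (2 / Real.sqrt y) := by
  have hp0 : 0 < p := hy.trans hyp
  have hden : 0 < p - T := by linarith
  have hsy : Real.sqrt y ≤ Real.sqrt p := Real.sqrt_le_sqrt hyp.le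
  have hsy0 : 0 < Real.sqrt y := Real.sqrt_pos.mpr hy
  have hsp : Real.sqrt p * Real.sqrt p = p := Real.mul_self_sqrt hp0.le
  have key : Real.sqrt p ≤ 2 / Real.sqrt y * (p - T) := by
    rw [div_mul_eq_mul_div, le_div_iff₀ hsy0]
    have := mul_le_mul_of_nonneg_left hsy (Real.sqrt_nonneg p)
    linarith
  rw [div_mul_eq_mul_div, div_le_iff₀ hden]
  calc cc * Real.sqrt p ≤ cc * (2 / Real.sqrt y * (p - T)) := mul_le_mul_of_nonneg_left key hcc
    _ = cc * (2 / Real.sqrt y) * (p - T) := by ring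

/-! ### The threshold -/

/-- The threshold `N₀(L, A, η)` of D2: for `N ≥ N₀`, `N ≥ max(1, 6L²)`, `log N > 0`, `N^{-1/8} ≤ η` (as
`-8 log η ≤ log N`), `y = truncLevel N ≥ 3`, and UNIFORMLY for `T ≤ (log log N)^A`: `y ≥ 2T` and `y ≥ 1024 T⁴`
(the growth toolkit `eventually_mul_pow_le_truncLevel`). [folklore] -/
theorem exists_tail_threshold (L A : ℕ) (η : ℝ) : ∃ N₀ : ℕ, ∀ N : ℕ, N₀ ≤ N →
    1 ≤ N ∧ 6 * L ^ 2 ≤ N ∧ 0 < Real.log N ∧ -8 * Real.log η ≤ Real.log N ∧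
      (3 : ℝ) ≤ (truncLevel N : ℝ) ∧
      ∀ T : ℕ, (T : ℝ) ≤ Real.log (Real.log N) ^ A →
        2 * (T : ℝ) ≤ (truncLevel N : ℝ) ∧ 1024 * (T : ℝ) ^ 4 ≤ (truncLevel N : ℝ) := by
  have h : ∀ᶠ N : ℕ in atTop, 1 ≤ N ∧ 6 * L ^ 2 ≤ N ∧ 0 < Real.log N ∧ -8 * Real.log η ≤ Real.log N ∧
      (3 : ℝ) ≤ (truncLevel N : ℝ) ∧
      ∀ T : ℕ, (T : ℝ) ≤ Real.log (Real.log N) ^ A →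
        2 * (T : ℝ) ≤ (truncLevel N : ℝ) ∧ 1024 * (T : ℝ) ^ 4 ≤ (truncLevel N : ℝ) := by
    filter_upwards [eventually_ge_atTop 1, eventually_ge_atTop (6 * L ^ 2), eventually_log_pos,
      eventually_mul_loglog_pow_le 0 (-8 * Real.log η) one_pos, eventually_mul_loglog_pow_le_truncLevel 0 3,
      eventually_mul_pow_le_truncLevel A 1 2, eventually_mul_pow_le_truncLevel A 4 1024]
      with N h1 h2 h3 h4 h5 h6 h7
    rw [pow_zero, mul_one, one_mul] at h4
    rw [pow_zero, mul_one] at h5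
    exact ⟨h1, h2, h3, h4, h5, fun T hT => ⟨by simpa only [pow_one] using h6 T hT, h7 T hT⟩⟩
  obtain ⟨N₀, hN₀⟩ := Filter.eventually_atTop.mp h
  exact ⟨N₀, hN₀⟩

/-! ### D2 -/

/-- **D2 = `TailCollisions` holds**: for `N ≥ N₀(L, A, η)`, uniformly in `(m+1)t ≤ (log log N)^A`, pointwise in a
non-degenerate shift `H` of the box, `∑_{Q ⊆ primes(y,x], ∏Q > √N} ∏_{p∈Q} collisionCount(H,p)/(p − (m+1)t) ≤ η`:
Rankin with exponent `1/2` (`prod_le_rankin`), `∑_Q ∏ = ∏ (1 + ·)` (`Finset.prod_one_add`), `∏(1+u) ≤ e^{∑u}`, the weight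
bound `div_mul_sqrt_le`, few collision primes (`sum_collisionCount_le`), and `N^{-1/4} e^{(log N)/8} = N^{-1/8} ≤ η`.
[cite: Gallagher1976, Section 2] -/
theorem tailCollisions : TailCollisions := by
  unfold TailCollisions
  intro t L A _ht η hη
  obtain ⟨N₀, hN₀⟩ := exists_tail_threshold L A η
  refine ⟨N₀, fun N hN m hmT Ψ _hΨ hL H hHb hH x => ?_⟩
  obtain ⟨hN1, hNL, hlogN, hlogη, hy3, hT'⟩ := hN₀ N hN
  obtain ⟨hy2T, hyT4⟩ := hT' ((m + 1) * t) hmT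
  have hy2 : 2 ≤ truncLevel N := by
    have h : (2 : ℝ) ≤ (truncLevel N : ℝ) := by linarith
    exact_mod_cast h
  -- membership in the prime window
  have hWmem : ∀ p ∈ primeWindow (truncLevel N) x, p.Prime ∧ truncLevel N < p := fun p hp => by
    simp only [primeWindow, Finset.mem_filter, Finset.mem_Ioc] at hp
    exact ⟨hp.2, hp.1.1⟩
  -- few collision primes
  have hsumcc := sum_collisionCount_le Ψ H hH hN1 hL hHb hy2 (primeWindow (truncLevel N) x) hWmem
  -- notation
  set T : ℕ := (m + 1) * t
  set y : ℕ := truncLevel N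
  set W : Finset ℕ := primeWindow y x
  set c : ℕ → ℝ := fun p => (collisionCount Ψ H p : ℝ) / ((p : ℝ) - (T : ℝ))
  set R : ℝ := Real.sqrt (Real.sqrt N) with hRdef
  show ∑ Q ∈ (W.powerset).filter (fun Q => Nat.sqrt N < ∏ p ∈ Q, p), ∏ p ∈ Q, c p ≤ η
  have hN0 : (0 : ℝ) < N := by exact_mod_cast hN1
  have hy0 : (0 : ℝ) < y := by linarith
  have hR0 : 0 < R := Real.sqrt_pos.mpr (Real.sqrt_pos.mpr hN0)
  have hlogR : Real.log R = Real.log N / 4 := by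
    rw [hRdef, Real.log_sqrt (Real.sqrt_nonneg _), Real.log_sqrt hN0.le]
    ring
  have hpW : ∀ p ∈ W, 2 * (T : ℝ) ≤ p ∧ (y : ℝ) < p := fun p hp =>
    ⟨hy2T.trans (by exact_mod_cast (hWmem p hp).2.le), by exact_mod_cast (hWmem p hp).2⟩
  have hc0 : ∀ p ∈ W, 0 ≤ c p := fun p hp => by
    obtain ⟨h2T, hyp⟩ := hpW p hp
    exact div_nonneg (Nat.cast_nonneg _) (by linarith)
  -- the weight bound `c_p √p ≤ 2 cc_p / √y`
  have hcw : ∀ p ∈ W, c p * Real.sqrt p ≤ (collisionCount Ψ H p : ℝ) * (2 / Real.sqrt y) := fun p hp =>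
    div_mul_sqrt_le (Nat.cast_nonneg _) hy0 (hpW p hp).2 (hpW p hp).1
  -- `log(6L²N) ≤ 2 log N`
  have hlogh : Real.log ((6 * L ^ 2 * N : ℕ) : ℝ) ≤ 2 * Real.log N := by
    have h1 : 6 * L ^ 2 * N ≤ N * N := Nat.mul_le_mul_right N hNL
    rcases Nat.eq_zero_or_pos (6 * L ^ 2 * N) with h0 | hpos
    · rw [h0, Nat.cast_zero, Real.log_zero]
      linarith
    · calc Real.log ((6 * L ^ 2 * N : ℕ) : ℝ) ≤ Real.log ((N * N : ℕ) : ℝ) :=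
            Real.log_le_log (by exact_mod_cast hpos) (by exact_mod_cast h1)
        _ = 2 * Real.log N := by
            push_cast
            rw [Real.log_mul hN0.ne' hN0.ne']
            ring
  -- `log y ≥ 1` and `√y ≥ 32 T²`
  have hlogy : 1 ≤ Real.log y := by
    rw [Real.le_log_iff_exp_le hy0]
    have := Real.exp_one_lt_d9
    linarith
  have hsqrt : 32 * (T : ℝ) ^ 2 ≤ Real.sqrt y := by
    rw [Real.le_sqrt (by positivity) hy0.le]
    have h : (32 * (T : ℝ) ^ 2) ^ 2 = 1024 * (T : ℝ) ^ 4 := by ring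
    rw [h]
    exact hyT4
  -- the exponent
  have hexp : ∑ p ∈ W, c p * Real.sqrt p ≤ Real.log N / 8 := by
    have hsy0 : 0 < Real.sqrt y := Real.sqrt_pos.mpr hy0
    have hden : 0 < Real.sqrt y * Real.log y := mul_pos hsy0 (by linarith)
    calc ∑ p ∈ W, c p * Real.sqrt p ≤ ∑ p ∈ W, (collisionCount Ψ H p : ℝ) * (2 / Real.sqrt y) :=
          Finset.sum_le_sum hcw
      _ = 2 / Real.sqrt y * ∑ p ∈ W, (collisionCount Ψ H p : ℝ) := by rw [← Finset.sum_mul, mul_comm]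
      _ ≤ 2 / Real.sqrt y * ((T : ℝ) ^ 2 * (Real.log ((6 * L ^ 2 * N : ℕ) : ℝ) / Real.log y)) :=
          mul_le_mul_of_nonneg_left hsumcc (by positivity)
      _ ≤ 2 / Real.sqrt y * ((T : ℝ) ^ 2 * (2 * Real.log N / Real.log y)) :=
          mul_le_mul_of_nonneg_left (mul_le_mul_of_nonneg_left
            (div_le_div_of_nonneg_right hlogh (by linarith)) (by positivity)) (by positivity)
      _ = 4 * (T : ℝ) ^ 2 * Real.log N / (Real.sqrt y * Real.log y) := by
          have hsyne : Real.sqrt y ≠ 0 := hsy0.ne'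
          have hlogyne : Real.log y ≠ 0 := (by linarith : (0 : ℝ) < Real.log y).ne'
          field_simp
          ring
      _ ≤ Real.log N / 8 := by
          rw [div_le_div_iff₀ hden (by norm_num : (0 : ℝ) < 8)]
          have h32 : 32 * (T : ℝ) ^ 2 ≤ Real.sqrt y * Real.log y := by
            have := mul_le_mul hsqrt hlogy zero_le_one (Real.sqrt_nonneg (y : ℝ))
            linarith
          have := mul_le_mul_of_nonneg_left h32 hlogN.le
          linarith
  -- Rankin, termwise
  have hterm : ∀ Q ∈ (W.powerset).filter (fun Q => Nat.sqrt N < ∏ p ∈ Q, p),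
      ∏ p ∈ Q, c p ≤ R⁻¹ * ∏ p ∈ Q, (c p * Real.sqrt p) := by
    intro Q hQ
    rw [Finset.mem_filter, Finset.mem_powerset] at hQ
    exact prod_le_rankin Q c (fun p hp => hc0 p (hQ.1 hp)) hN1 hQ.2
  -- assembly
  calc ∑ Q ∈ (W.powerset).filter (fun Q => Nat.sqrt N < ∏ p ∈ Q, p), ∏ p ∈ Q, c p
      ≤ ∑ Q ∈ (W.powerset).filter (fun Q => Nat.sqrt N < ∏ p ∈ Q, p), R⁻¹ * ∏ p ∈ Q, (c p * Real.sqrt p) :=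
        Finset.sum_le_sum hterm
    _ ≤ ∑ Q ∈ W.powerset, R⁻¹ * ∏ p ∈ Q, (c p * Real.sqrt p) :=
        Finset.sum_le_sum_of_subset_of_nonneg (Finset.filter_subset _ _) fun Q hQ _ =>
          mul_nonneg (inv_nonneg.mpr hR0.le) (Finset.prod_nonneg fun p hp =>
            mul_nonneg (hc0 p (Finset.mem_powerset.mp hQ hp)) (Real.sqrt_nonneg _))
    _ = R⁻¹ * ∏ p ∈ W, (1 + c p * Real.sqrt p) := by rw [Finset.prod_one_add, Finset.mul_sum]
    _ ≤ R⁻¹ * Real.exp (∑ p ∈ W, c p * Real.sqrt p) :=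
        mul_le_mul_of_nonneg_left (prod_one_add_le_exp_sum W _ fun p hp =>
          mul_nonneg (hc0 p hp) (Real.sqrt_nonneg _)) (inv_nonneg.mpr hR0.le)
    _ ≤ R⁻¹ * Real.exp (Real.log N / 8) :=
        mul_le_mul_of_nonneg_left (Real.exp_le_exp.mpr hexp) (inv_nonneg.mpr hR0.le)
    _ = Real.exp (-(Real.log N / 8)) := by
        rw [← Real.exp_log hR0, ← Real.exp_neg, ← Real.exp_add, hlogR]
        congr 1
        ring
    _ ≤ Real.exp (Real.log η) := Real.exp_le_exp.mpr (by linarith)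
    _ = η := Real.exp_log hη

/-! ### The registered stub -/

/-- **Stub C ∧ D2 of the line `Sketch`** (`stub_collisionFormFactsAndTail`): the collision-form facts
(`collisionFormFacts`, Theorems/LeeYangFibresAbsoluteUpgradeUniformCollisionForms) and the Rankin tail bound
(`tailCollisions`). [cite: Gallagher1976, Section 2] -/
theorem stub_collisionFormFactsAndTail : CollisionFormFacts ∧ TailCollisions :=
  ⟨collisionFormFacts, tailCollisions⟩

end Summit.Parity.GeneralizedHardyLittlewood.Cruxes.AbsoluteUpgrade.UniformAmplification

end
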